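import Summits.Langlands.Langlands.Theorems.SqrtFiveQuarticCoversGroupCensusFive
import Summits.Langlands.Langlands.Theorems.SqrtFiveQuarticCoversTraceDetTables
import Summits.Langlands.Langlands.Theorems.SqrtFiveQuarticCoversTraceDetTablesThree
import Summits.Langlands.Langlands.Theorems.SqrtFiveQuarticCoversTraceDetTablesSeven

/-!
# Frobenius `(trace, det)`-witnesses at ONE prime `ℓ ∈ {3, 5, 7}` ⇒ modular — the E11 bridge by decl
# (route `SqrtFiveQuarticCovers`, cell `pub/lg-quartmod`, F-L1; CONDITIONAL on three named facts)

Route `Langlands/SqrtFiveQuarticCovers`.  The route's reduction crux `ReductionToRefinedLocus`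
(item stmt-Langlands-17834) holds modulo the three named lifting facts `FLS2015_theorem3`,
`FLS2015_theorem4`, `Kalyanswamy2018_theorem1_2`
(`Summit.Langlands.Langlands.Theorems.GroupCensusFive.reductionToRefinedLocus_of_liftingTheorems`):
a NON-modular elliptic curve `E` over a totally real quartic `K ∋ √5` has, for SOME framing of each
`E[ℓ]`, mod-`3` image Borel or inside `C_s⁺(3)`, mod-`5` image Borel or inside `H8` or `H12`, and
mod-`7` image Borel or inside `G(e7)`.  The cell's verdict tool E11 discharges individual curves by
exhibiting Frobenius elements whose `(trace, det) = (a_𝔓 mod ℓ, N𝔓 mod ℓ)` is incompatible with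
every one of these subgroups at ONE prime `ℓ`; the finite group theory behind each flag is
kernel-checked in `SqrtFiveQuarticCoversTraceDetTables{,Three,Seven}` (kill-lemmas in conjugation
form `¬ ∃ x, …`).

This file is the missing COMPOSITION: for `K` totally real quartic with `√5 ∈ K`, `E / 𝓞 K` with
`Δ ≠ 0`, and one prime `ℓ`, if EVERY framing `ρ̄` of `E[ℓ]` (the reduction's clauses carry the
conjugation inside the choice of framing, so the hypothesis quantifies over framings; `(trace, det)`
of `ρ̄(σ)` is framing-independent, so one dictionary row serves all framings) has image elements
with the flag's data, then `E` is modular (`IsModularEllipticCurve K E`, definitionally the route's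
written-out disjunction "geometric CM or a weight-zero cuspidal `π` with cofinite trace match"):

* `isModularEllipticCurve_of_witness_three` — `ℓ = 3`, ONE element of determinant `2` and non-zero
  trace (flag «large at 3»: `N𝔓 ≡ 2 (3)`, `a_𝔓 ≢ 0 (3)`); `…_three_disc` — the discriminant form
  (non-zero trace, `trace² − 4 det` a non-square);
* `isModularEllipticCurve_of_witnesses_five` — `ℓ = 5`, one element with non-square
  `trace² − 4 det` (not Borel) and one of determinant `−1` and non-zero trace (neither `H8` nor
  `H12`); `…_of_witness_five` — ONE element of determinant `−1` and trace `±2` does both;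
  `…_of_witnesses_five_det_one` — determinant-one witnesses of traces `±1` and `0`;
* `isModularEllipticCurve_of_witnesses_seven` — `ℓ = 7`, flags `W7b + W7ns`: one element with
  non-square discriminant, one with non-zero trace and non-zero square discriminant;
  `…_of_witness_seven` — ONE element with `det ∈ {3,5,6}`, non-zero trace, non-square discriminant.

All CONDITIONAL on the three named Literature facts (hypotheses `h3 h4 hKal`, exactly those of the
route's reduction; deep modularity lifting theorems, cited not proved).  Glue only: no definitions,
standard axioms.  HONEST: nothing here proves modularity of any particular curve — the dictionary
`(N𝔓, a_𝔓(E)) ↦ (det, trace)` of `ρ̄_{E,ℓ}(Frob_𝔓)` at a good prime `𝔓 ∤ ℓ`, which turns a row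
of point counts into the witness hypothesis, is the user's (computational) input, and the three
lifting theorems are assumed.
References: [FreitasLeHungSiksek2015] Thms 3, 4, Prop. 1.1, Remark (iii) after Cor. 2.1;
[Kalyanswamy2018] Thm 1.2; [Box2022] Thm 7.1.
-/

set_option linter.dupNamespace false -- project-wide option (lakefile weak.linter.dupNamespace); `Summit.Langlands.Langlands` is the mandated namespace

namespace Summit.Langlands.Langlands.Theorems.SqrtFiveQuarticCovers

open scoped Matrix NumberField
open Literature.NumberTheory.Automorphic Literature.NumberTheory.GaloisRepresentations

/-! ## 1. `ℓ = 3` -/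

/-- **«Large at 3» ⇒ modular (modulo FLS Thms 3–4, Kalyanswamy Thm 1.2).**  `K` totally real
quartic with `√5 ∈ K`, `E / 𝓞 K` with `Δ ≠ 0`.  If for every framing `ρ̄` of `E[3]` some `ρ̄(σ)`
has determinant `2` and non-zero trace (one good prime `𝔓 ∤ 3` with `N𝔓 ≡ 2 (mod 3)` and
`a_𝔓(E) ≢ 0 (mod 3)`), then `E` is modular: such an element lies in no Borel and in no conjugate
of `C_s⁺(3)` (`not_borel_or_conj_Cs3_of_witness`), contradicting the `3`-clause of
`reductionToRefinedLocus_of_liftingTheorems`. [cite: FreitasLeHungSiksek2015, Thm. 3 and Prop. 1.1(a)] -/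
theorem isModularEllipticCurve_of_witness_three (h3 : FLS2015_theorem3) (h4 : FLS2015_theorem4)
    (hKal : Kalyanswamy2018_theorem1_2) :
    ∀ (K : Type) [Field K] [NumberField K], NumberField.IsTotallyReal K → Module.finrank ℚ K = 4 →
      (∃ r : K, r ^ 2 = 5) → ∀ E : WeierstrassCurve (NumberField.RingOfIntegers K), E.Δ ≠ 0 →
      (∀ ρ : FramedGaloisRep K (ZMod 3) 2,
        (∃ e : (E.baseChange K).geomTorsion ((3 : ℕ) : ℤ) ≃+ (Fin 2 → ZMod 3),
          ∀ (σ : Field.absoluteGaloisGroup K) (P : (E.baseChange K).geomTorsion ((3 : ℕ) : ℤ)),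
            e (σ • P) = ((ρ σ : GL (Fin 2) (ZMod 3)) : Matrix (Fin 2) (Fin 2) (ZMod 3)) *ᵥ (e P)) →
        ∃ σ : Field.absoluteGaloisGroup K,
          Matrix.det ((ρ σ : GL (Fin 2) (ZMod 3)) : Matrix (Fin 2) (Fin 2) (ZMod 3)) = 2 ∧
          Matrix.trace ((ρ σ : GL (Fin 2) (ZMod 3)) : Matrix (Fin 2) (Fin 2) (ZMod 3)) ≠ 0) →
      IsModularEllipticCurve K E := by
  intro K _ _ hK hdeg h5 E hE hw
  by_contra hne
  obtain ⟨⟨ρ, hρ, hcl⟩, -, -⟩ :=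
    GroupCensusFive.reductionToRefinedLocus_of_liftingTheorems h3 h4 hKal K hK hdeg h5 E hE hne
  obtain ⟨σ, hd, ht⟩ := hw ρ hρ
  refine not_borel_or_conj_Cs3_of_witness (G := ρ.toMonoidHom.range) (g := ρ σ) ⟨σ, rfl⟩ hd ht
    ⟨1, ?_⟩
  rcases hcl with h | h
  · exact Or.inl (by rintro _ ⟨τ, rfl⟩; rw [one_mul, inv_one, mul_one]; exact h τ)
  · exact Or.inr (by rintro _ ⟨τ, rfl⟩; rw [one_mul, inv_one, mul_one]; exact h τ)

/-- **«Large at 3», discriminant form (flags `W3b + W3s` on one element) ⇒ modular** (modulo the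
three named facts): for every framing of `E[3]` some `ρ̄(σ)` has non-zero trace and NON-SQUARE
`trace² − 4 det` (`not_borel_or_conj_Cs3_of_witness_disc`). [cite: FreitasLeHungSiksek2015, Thm. 3 and Prop. 1.1(a)] -/
theorem isModularEllipticCurve_of_witness_three_disc (h3 : FLS2015_theorem3) (h4 : FLS2015_theorem4)
    (hKal : Kalyanswamy2018_theorem1_2) :
    ∀ (K : Type) [Field K] [NumberField K], NumberField.IsTotallyReal K → Module.finrank ℚ K = 4 →
      (∃ r : K, r ^ 2 = 5) → ∀ E : WeierstrassCurve (NumberField.RingOfIntegers K), E.Δ ≠ 0 →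
      (∀ ρ : FramedGaloisRep K (ZMod 3) 2,
        (∃ e : (E.baseChange K).geomTorsion ((3 : ℕ) : ℤ) ≃+ (Fin 2 → ZMod 3),
          ∀ (σ : Field.absoluteGaloisGroup K) (P : (E.baseChange K).geomTorsion ((3 : ℕ) : ℤ)),
            e (σ • P) = ((ρ σ : GL (Fin 2) (ZMod 3)) : Matrix (Fin 2) (Fin 2) (ZMod 3)) *ᵥ (e P)) →
        ∃ σ : Field.absoluteGaloisGroup K,
          Matrix.trace ((ρ σ : GL (Fin 2) (ZMod 3)) : Matrix (Fin 2) (Fin 2) (ZMod 3)) ≠ 0 ∧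
          ¬ IsSquare (Matrix.trace ((ρ σ : GL (Fin 2) (ZMod 3)) : Matrix (Fin 2) (Fin 2) (ZMod 3)) ^ 2 -
            4 * Matrix.det ((ρ σ : GL (Fin 2) (ZMod 3)) : Matrix (Fin 2) (Fin 2) (ZMod 3)))) →
      IsModularEllipticCurve K E := by
  intro K _ _ hK hdeg h5 E hE hw
  by_contra hne
  obtain ⟨⟨ρ, hρ, hcl⟩, -, -⟩ :=
    GroupCensusFive.reductionToRefinedLocus_of_liftingTheorems h3 h4 hKal K hK hdeg h5 E hE hne
  obtain ⟨σ, ht, hns⟩ := hw ρ hρ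
  refine not_borel_or_conj_Cs3_of_witness_disc (G := ρ.toMonoidHom.range) (g := ρ σ) ⟨σ, rfl⟩
    ht hns ⟨1, ?_⟩
  rcases hcl with h | h
  · exact Or.inl (by rintro _ ⟨τ, rfl⟩; rw [one_mul, inv_one, mul_one]; exact h τ)
  · exact Or.inr (by rintro _ ⟨τ, rfl⟩; rw [one_mul, inv_one, mul_one]; exact h τ)

/-! ## 2. `ℓ = 5` -/

/-- **«Outside the refined locus at 5» ⇒ modular (modulo FLS Thms 3–4, Kalyanswamy Thm 1.2).**
`K` totally real quartic with `√5 ∈ K`, `E / 𝓞 K` with `Δ ≠ 0`.  If for every framing `ρ̄` of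
`E[5]` the image contains an element with NON-SQUARE `trace² − 4 det` (not Borel:
`not_conj_borel_of_witness`) and an element of determinant `−1` and non-zero trace (in no conjugate
of `H8` or `H12`: `GroupCensusFive.not_conj_H8_or_H12_of_witness`; flags `W5H8 ∧ W5H12`: one good
prime with `N𝔓 ≡ 4 (mod 5)`, `a_𝔓 ≢ 0 (mod 5)`), then `E` is modular — the `5`-clause of
`reductionToRefinedLocus_of_liftingTheorems` fails. [cite: FreitasLeHungSiksek2015, Thm. 3 and Remark (iii) after Cor. 2.1] -/
theorem isModularEllipticCurve_of_witnesses_five (h3 : FLS2015_theorem3) (h4 : FLS2015_theorem4)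
    (hKal : Kalyanswamy2018_theorem1_2) :
    ∀ (K : Type) [Field K] [NumberField K], NumberField.IsTotallyReal K → Module.finrank ℚ K = 4 →
      (∃ r : K, r ^ 2 = 5) → ∀ E : WeierstrassCurve (NumberField.RingOfIntegers K), E.Δ ≠ 0 →
      (∀ ρ : FramedGaloisRep K (ZMod 5) 2,
        (∃ e : (E.baseChange K).geomTorsion ((5 : ℕ) : ℤ) ≃+ (Fin 2 → ZMod 5),
          ∀ (σ : Field.absoluteGaloisGroup K) (P : (E.baseChange K).geomTorsion ((5 : ℕ) : ℤ)),
            e (σ • P) = ((ρ σ : GL (Fin 2) (ZMod 5)) : Matrix (Fin 2) (Fin 2) (ZMod 5)) *ᵥ (e P)) →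
        (∃ σ : Field.absoluteGaloisGroup K,
          ¬ IsSquare (Matrix.trace ((ρ σ : GL (Fin 2) (ZMod 5)) : Matrix (Fin 2) (Fin 2) (ZMod 5)) ^ 2 -
            4 * Matrix.det ((ρ σ : GL (Fin 2) (ZMod 5)) : Matrix (Fin 2) (Fin 2) (ZMod 5)))) ∧
        (∃ σ : Field.absoluteGaloisGroup K,
          Matrix.det ((ρ σ : GL (Fin 2) (ZMod 5)) : Matrix (Fin 2) (Fin 2) (ZMod 5)) = -1 ∧
          Matrix.trace ((ρ σ : GL (Fin 2) (ZMod 5)) : Matrix (Fin 2) (Fin 2) (ZMod 5)) ≠ 0)) →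
      IsModularEllipticCurve K E := by
  intro K _ _ hK hdeg h5 E hE hw
  by_contra hne
  obtain ⟨-, h5c, -⟩ :=
    GroupCensusFive.reductionToRefinedLocus_of_liftingTheorems h3 h4 hKal K hK hdeg h5 E hE hne
  rcases h5c with ⟨ρ, hρ, hB⟩ | ⟨ρ, hρ, hH⟩
  · obtain ⟨⟨σ, hns⟩, -⟩ := hw ρ hρ
    refine not_conj_borel_of_witness (G := ρ.toMonoidHom.range) (g := ρ σ) ⟨σ, rfl⟩ hns ⟨1, ?_⟩
    rintro _ ⟨τ, rfl⟩; rw [one_mul, inv_one, mul_one]; exact hB τ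
  · obtain ⟨-, σ, hd, ht⟩ := hw ρ hρ
    refine GroupCensusFive.not_conj_H8_or_H12_of_witness (G := ρ.toMonoidHom.range) (g := ρ σ)
      ⟨σ, rfl⟩ hd ht ⟨1, ?_⟩
    rcases hH with h | h
    · exact Or.inl (by rintro _ ⟨τ, rfl⟩; rw [one_mul, inv_one, mul_one]; exact h τ)
    · exact Or.inr (by rintro _ ⟨τ, rfl⟩; rw [one_mul, inv_one, mul_one]; exact h τ)

/-- In `GL₂(𝔽₅)`, determinant `−1` and trace `±2` give the non-square discriminant
`trace² − 4 det = 3`. [folklore] -/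
theorem not_isSquare_disc_of_det_neg_one_trace_two {M : Matrix (Fin 2) (Fin 2) (ZMod 5)}
    (hd : M.det = -1) (ht : M.trace = 2 ∨ M.trace = 3) :
    ¬ IsSquare (M.trace ^ 2 - 4 * M.det) := by
  rw [hd]
  rcases ht with ht | ht <;> rw [ht] <;> decide

/-- **ONE Frobenius ⇒ modular at `5` (modulo the three named facts):** for every framing of `E[5]`
some `ρ̄(σ)` has determinant `−1` and trace `2` or `3` (one good prime with `N𝔓 ≡ 4 (mod 5)` and
`a_𝔓(E) ≡ ±2 (mod 5)`).  Such an element has non-square discriminant `3`, so it alone excludes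
Borel, `H8` and `H12`. [cite: FreitasLeHungSiksek2015, Thm. 3 and Remark (iii) after Cor. 2.1] -/
theorem isModularEllipticCurve_of_witness_five (h3 : FLS2015_theorem3) (h4 : FLS2015_theorem4)
    (hKal : Kalyanswamy2018_theorem1_2) :
    ∀ (K : Type) [Field K] [NumberField K], NumberField.IsTotallyReal K → Module.finrank ℚ K = 4 →
      (∃ r : K, r ^ 2 = 5) → ∀ E : WeierstrassCurve (NumberField.RingOfIntegers K), E.Δ ≠ 0 →
      (∀ ρ : FramedGaloisRep K (ZMod 5) 2,
        (∃ e : (E.baseChange K).geomTorsion ((5 : ℕ) : ℤ) ≃+ (Fin 2 → ZMod 5),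
          ∀ (σ : Field.absoluteGaloisGroup K) (P : (E.baseChange K).geomTorsion ((5 : ℕ) : ℤ)),
            e (σ • P) = ((ρ σ : GL (Fin 2) (ZMod 5)) : Matrix (Fin 2) (Fin 2) (ZMod 5)) *ᵥ (e P)) →
        ∃ σ : Field.absoluteGaloisGroup K,
          Matrix.det ((ρ σ : GL (Fin 2) (ZMod 5)) : Matrix (Fin 2) (Fin 2) (ZMod 5)) = -1 ∧
          (Matrix.trace ((ρ σ : GL (Fin 2) (ZMod 5)) : Matrix (Fin 2) (Fin 2) (ZMod 5)) = 2 ∨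
            Matrix.trace ((ρ σ : GL (Fin 2) (ZMod 5)) : Matrix (Fin 2) (Fin 2) (ZMod 5)) = 3)) →
      IsModularEllipticCurve K E := by
  intro K _ _ hK hdeg h5 E hE hw
  refine isModularEllipticCurve_of_witnesses_five h3 h4 hKal K hK hdeg h5 E hE fun ρ hρ => ?_
  obtain ⟨σ, hd, ht⟩ := hw ρ hρ
  refine ⟨⟨σ, not_isSquare_disc_of_det_neg_one_trace_two hd ht⟩, σ, hd, ?_⟩
  rcases ht with ht | ht <;> rw [ht] <;> decide

/-- In `GL₂(𝔽₅)`, determinant `1` and trace `±1` give the non-square discriminant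
`trace² − 4 det = 2`. [folklore] -/
theorem not_isSquare_disc_of_det_one_trace_one {M : Matrix (Fin 2) (Fin 2) (ZMod 5)}
    (hd : M.det = 1) (ht : M.trace = 1 ∨ M.trace = 4) :
    ¬ IsSquare (M.trace ^ 2 - 4 * M.det) := by
  rw [hd]
  rcases ht with ht | ht <;> rw [ht] <;> decide

/-- **Determinant-one witnesses at `5` ⇒ modular (modulo the three named facts):** for every framing
of `E[5]` the image contains an element of determinant `1` and trace `±1` (non-square discriminant
`2`: not Borel; and not in a conjugate of `H8`, `GroupCensusFive.not_conj_H8_of_witness_det_one`)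
and an element of determinant `1` and trace `0` (not in a conjugate of `H12`,
`GroupCensusFive.not_conj_H12_of_witness_det_one`) — two good primes with `N𝔓 ≡ 1 (mod 5)` and
`a_𝔓 ≡ ±1`, resp. `a_𝔓 ≡ 0 (mod 5)`. [cite: FreitasLeHungSiksek2015, Thm. 3 and Remark (iii) after Cor. 2.1] -/
theorem isModularEllipticCurve_of_witnesses_five_det_one (h3 : FLS2015_theorem3)
    (h4 : FLS2015_theorem4) (hKal : Kalyanswamy2018_theorem1_2) :
    ∀ (K : Type) [Field K] [NumberField K], NumberField.IsTotallyReal K → Module.finrank ℚ K = 4 →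
      (∃ r : K, r ^ 2 = 5) → ∀ E : WeierstrassCurve (NumberField.RingOfIntegers K), E.Δ ≠ 0 →
      (∀ ρ : FramedGaloisRep K (ZMod 5) 2,
        (∃ e : (E.baseChange K).geomTorsion ((5 : ℕ) : ℤ) ≃+ (Fin 2 → ZMod 5),
          ∀ (σ : Field.absoluteGaloisGroup K) (P : (E.baseChange K).geomTorsion ((5 : ℕ) : ℤ)),
            e (σ • P) = ((ρ σ : GL (Fin 2) (ZMod 5)) : Matrix (Fin 2) (Fin 2) (ZMod 5)) *ᵥ (e P)) →
        (∃ σ : Field.absoluteGaloisGroup K,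
          Matrix.det ((ρ σ : GL (Fin 2) (ZMod 5)) : Matrix (Fin 2) (Fin 2) (ZMod 5)) = 1 ∧
          (Matrix.trace ((ρ σ : GL (Fin 2) (ZMod 5)) : Matrix (Fin 2) (Fin 2) (ZMod 5)) = 1 ∨
            Matrix.trace ((ρ σ : GL (Fin 2) (ZMod 5)) : Matrix (Fin 2) (Fin 2) (ZMod 5)) = 4)) ∧
        (∃ σ : Field.absoluteGaloisGroup K,
          Matrix.det ((ρ σ : GL (Fin 2) (ZMod 5)) : Matrix (Fin 2) (Fin 2) (ZMod 5)) = 1 ∧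
          Matrix.trace ((ρ σ : GL (Fin 2) (ZMod 5)) : Matrix (Fin 2) (Fin 2) (ZMod 5)) = 0)) →
      IsModularEllipticCurve K E := by
  intro K _ _ hK hdeg h5 E hE hw
  by_contra hne
  obtain ⟨-, h5c, -⟩ :=
    GroupCensusFive.reductionToRefinedLocus_of_liftingTheorems h3 h4 hKal K hK hdeg h5 E hE hne
  rcases h5c with ⟨ρ, hρ, hB⟩ | ⟨ρ, hρ, hH⟩
  · obtain ⟨⟨σ, hd, ht⟩, -⟩ := hw ρ hρ
    refine not_conj_borel_of_witness (G := ρ.toMonoidHom.range) (g := ρ σ) ⟨σ, rfl⟩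
      (not_isSquare_disc_of_det_one_trace_one hd ht) ⟨1, ?_⟩
    rintro _ ⟨τ, rfl⟩; rw [one_mul, inv_one, mul_one]; exact hB τ
  · obtain ⟨⟨σ, hd, ht⟩, σ', hd', ht'⟩ := hw ρ hρ
    refine GroupCensusFive.not_conj_H8_or_H12_of_witnesses_det_one (G := ρ.toMonoidHom.range)
      (g := ρ σ) (g' := ρ σ') ⟨σ, rfl⟩ ⟨σ', rfl⟩ hd ht hd' ht' ⟨1, ?_⟩
    rcases hH with h | h
    · exact Or.inl (by rintro _ ⟨τ, rfl⟩; rw [one_mul, inv_one, mul_one]; exact h τ)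
    · exact Or.inr (by rintro _ ⟨τ, rfl⟩; rw [one_mul, inv_one, mul_one]; exact h τ)

/-! ## 3. `ℓ = 7` -/

/-- **«Large at 7» (flags `W7b + W7ns`) ⇒ modular (modulo FLS Thms 3–4, Kalyanswamy Thm 1.2).**
`K` totally real quartic with `√5 ∈ K`, `E / 𝓞 K` with `Δ ≠ 0`.  If for every framing `ρ̄` of
`E[7]` the image contains an element with NON-SQUARE `trace² − 4 det` (not Borel) and an element
with non-zero trace and non-zero SQUARE `trace² − 4 det` (in no conjugate of `G(e7)`), then `E` is
modular: `not_borel_or_conj_Ge7_of_witnesses` against the `7`-clause of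
`reductionToRefinedLocus_of_liftingTheorems`. [cite: FreitasLeHungSiksek2015, Thm. 4 and Prop. 1.1(c)] [cite: Kalyanswamy2018, Thm. 1.2] -/
theorem isModularEllipticCurve_of_witnesses_seven (h3 : FLS2015_theorem3) (h4 : FLS2015_theorem4)
    (hKal : Kalyanswamy2018_theorem1_2) :
    ∀ (K : Type) [Field K] [NumberField K], NumberField.IsTotallyReal K → Module.finrank ℚ K = 4 →
      (∃ r : K, r ^ 2 = 5) → ∀ E : WeierstrassCurve (NumberField.RingOfIntegers K), E.Δ ≠ 0 →
      (∀ ρ : FramedGaloisRep K (ZMod 7) 2,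
        (∃ e : (E.baseChange K).geomTorsion ((7 : ℕ) : ℤ) ≃+ (Fin 2 → ZMod 7),
          ∀ (σ : Field.absoluteGaloisGroup K) (P : (E.baseChange K).geomTorsion ((7 : ℕ) : ℤ)),
            e (σ • P) = ((ρ σ : GL (Fin 2) (ZMod 7)) : Matrix (Fin 2) (Fin 2) (ZMod 7)) *ᵥ (e P)) →
        (∃ σ : Field.absoluteGaloisGroup K,
          ¬ IsSquare (Matrix.trace ((ρ σ : GL (Fin 2) (ZMod 7)) : Matrix (Fin 2) (Fin 2) (ZMod 7)) ^ 2 -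
            4 * Matrix.det ((ρ σ : GL (Fin 2) (ZMod 7)) : Matrix (Fin 2) (Fin 2) (ZMod 7)))) ∧
        (∃ σ : Field.absoluteGaloisGroup K,
          Matrix.trace ((ρ σ : GL (Fin 2) (ZMod 7)) : Matrix (Fin 2) (Fin 2) (ZMod 7)) ≠ 0 ∧
          IsSquare (Matrix.trace ((ρ σ : GL (Fin 2) (ZMod 7)) : Matrix (Fin 2) (Fin 2) (ZMod 7)) ^ 2 -
            4 * Matrix.det ((ρ σ : GL (Fin 2) (ZMod 7)) : Matrix (Fin 2) (Fin 2) (ZMod 7))) ∧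
          Matrix.trace ((ρ σ : GL (Fin 2) (ZMod 7)) : Matrix (Fin 2) (Fin 2) (ZMod 7)) ^ 2 -
            4 * Matrix.det ((ρ σ : GL (Fin 2) (ZMod 7)) : Matrix (Fin 2) (Fin 2) (ZMod 7)) ≠ 0)) →
      IsModularEllipticCurve K E := by
  intro K _ _ hK hdeg h5 E hE hw
  by_contra hne
  obtain ⟨-, -, ρ, hρ, hcl⟩ :=
    GroupCensusFive.reductionToRefinedLocus_of_liftingTheorems h3 h4 hKal K hK hdeg h5 E hE hne
  obtain ⟨⟨σ, hns⟩, σ', ht', hD', hD0'⟩ := hw ρ hρ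
  refine not_borel_or_conj_Ge7_of_witnesses (G := ρ.toMonoidHom.range) (g := ρ σ) (g' := ρ σ')
    ⟨σ, rfl⟩ hns ⟨σ', rfl⟩ ht' hD' hD0' ⟨1, ?_⟩
  rcases hcl with h | h
  · exact Or.inl (by rintro _ ⟨τ, rfl⟩; rw [one_mul, inv_one, mul_one]; exact h τ)
  · exact Or.inr (by rintro _ ⟨τ, rfl⟩; rw [one_mul, inv_one, mul_one]; exact h τ)

/-- **«Large at 7» from ONE Frobenius ⇒ modular (modulo the three named facts):** for every framing
of `E[7]` some `ρ̄(σ)` has determinant in `{3, 5, 6}` (non-square), non-zero trace and non-square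
`trace² − 4 det` (e.g. `(a_𝔓, N𝔓) ≡ (1, 3) (mod 7)`): `not_borel_or_conj_Ge7_of_witness`.
[cite: FreitasLeHungSiksek2015, Thm. 4 and Prop. 1.1(c)] [cite: Kalyanswamy2018, Thm. 1.2] -/
theorem isModularEllipticCurve_of_witness_seven (h3 : FLS2015_theorem3) (h4 : FLS2015_theorem4)
    (hKal : Kalyanswamy2018_theorem1_2) :
    ∀ (K : Type) [Field K] [NumberField K], NumberField.IsTotallyReal K → Module.finrank ℚ K = 4 →
      (∃ r : K, r ^ 2 = 5) → ∀ E : WeierstrassCurve (NumberField.RingOfIntegers K), E.Δ ≠ 0 →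
      (∀ ρ : FramedGaloisRep K (ZMod 7) 2,
        (∃ e : (E.baseChange K).geomTorsion ((7 : ℕ) : ℤ) ≃+ (Fin 2 → ZMod 7),
          ∀ (σ : Field.absoluteGaloisGroup K) (P : (E.baseChange K).geomTorsion ((7 : ℕ) : ℤ)),
            e (σ • P) = ((ρ σ : GL (Fin 2) (ZMod 7)) : Matrix (Fin 2) (Fin 2) (ZMod 7)) *ᵥ (e P)) →
        ∃ σ : Field.absoluteGaloisGroup K,
          (Matrix.det ((ρ σ : GL (Fin 2) (ZMod 7)) : Matrix (Fin 2) (Fin 2) (ZMod 7)) = 3 ∨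
            Matrix.det ((ρ σ : GL (Fin 2) (ZMod 7)) : Matrix (Fin 2) (Fin 2) (ZMod 7)) = 5 ∨
            Matrix.det ((ρ σ : GL (Fin 2) (ZMod 7)) : Matrix (Fin 2) (Fin 2) (ZMod 7)) = 6) ∧
          Matrix.trace ((ρ σ : GL (Fin 2) (ZMod 7)) : Matrix (Fin 2) (Fin 2) (ZMod 7)) ≠ 0 ∧
          ¬ IsSquare (Matrix.trace ((ρ σ : GL (Fin 2) (ZMod 7)) : Matrix (Fin 2) (Fin 2) (ZMod 7)) ^ 2 -
            4 * Matrix.det ((ρ σ : GL (Fin 2) (ZMod 7)) : Matrix (Fin 2) (Fin 2) (ZMod 7)))) →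
      IsModularEllipticCurve K E := by
  intro K _ _ hK hdeg h5 E hE hw
  by_contra hne
  obtain ⟨-, -, ρ, hρ, hcl⟩ :=
    GroupCensusFive.reductionToRefinedLocus_of_liftingTheorems h3 h4 hKal K hK hdeg h5 E hE hne
  obtain ⟨σ, hd, ht, hns⟩ := hw ρ hρ
  refine not_borel_or_conj_Ge7_of_witness (G := ρ.toMonoidHom.range) (g := ρ σ) ⟨σ, rfl⟩ hd ht
    hns ⟨1, ?_⟩
  rcases hcl with h | h
  · exact Or.inl (by rintro _ ⟨τ, rfl⟩; rw [one_mul, inv_one, mul_one]; exact h τ)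
  · exact Or.inr (by rintro _ ⟨τ, rfl⟩; rw [one_mul, inv_one, mul_one]; exact h τ)

/-! ## 4. Fact-minimal forms (appended): `ℓ = 3` from FLS Thm 3 alone over ANY totally real `K`;
`ℓ = 7` from FLS Thm 4 + Kalyanswamy Thm 1.2 alone whenever `3 ∤ [K : ℚ]`
§§1–3 go through the route's reduction (three facts, `[K : ℚ] = 4`, `√5 ∈ K`).  The tree proves the
`3`-clause from `FLS2015_theorem3` alone over any totally real field (`Box2022.clause_three`) and the
`7`-clause from `FLS2015_theorem4` + `Kalyanswamy2018_theorem1_2` alone when `3 ∤ [K : ℚ]`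
(`Box2022.clause_seven_of_liftingTheorems`, `Box2022.cubic7_ne_zero`); the same kill-lemmas give the
forms below — E11's minimal discharging sets.  (At `3` the discriminant form is the same datum: for
`trace ≠ 0`, `trace² − 4 det = 1 − det` is a non-square of `𝔽₃` iff `det = 2`.) -/

/-- **«Large at 3» ⇒ modular over ANY totally real field, modulo FLS Thm 3 alone**: for every
framing of `E[3]` some `ρ̄(σ)` has determinant `2` and non-zero trace (`Box2022.clause_three` +
`not_borel_or_conj_Cs3_of_witness`). [cite: FreitasLeHungSiksek2015, Thm. 3 and Prop. 1.1(a)] -/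
theorem isModularEllipticCurve_of_witness_three_of_isTotallyReal (h3 : FLS2015_theorem3) :
    ∀ (K : Type) [Field K] [NumberField K], NumberField.IsTotallyReal K →
      ∀ E : WeierstrassCurve (NumberField.RingOfIntegers K), E.Δ ≠ 0 →
      (∀ ρ : FramedGaloisRep K (ZMod 3) 2,
        (∃ e : (E.baseChange K).geomTorsion ((3 : ℕ) : ℤ) ≃+ (Fin 2 → ZMod 3),
          ∀ (σ : Field.absoluteGaloisGroup K) (P : (E.baseChange K).geomTorsion ((3 : ℕ) : ℤ)),
            e (σ • P) = ((ρ σ : GL (Fin 2) (ZMod 3)) : Matrix (Fin 2) (Fin 2) (ZMod 3)) *ᵥ (e P)) →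
        ∃ σ : Field.absoluteGaloisGroup K,
          Matrix.det ((ρ σ : GL (Fin 2) (ZMod 3)) : Matrix (Fin 2) (Fin 2) (ZMod 3)) = 2 ∧
          Matrix.trace ((ρ σ : GL (Fin 2) (ZMod 3)) : Matrix (Fin 2) (Fin 2) (ZMod 3)) ≠ 0) →
      IsModularEllipticCurve K E := by
  intro K _ _ hK E hE hw
  haveI := hK
  by_contra hne
  obtain ⟨ρ, hρ, hcl⟩ := Box2022.clause_three h3 K E hE
    (not_isAutomorphicOfWeightZero_of_not_isModularEllipticCurve hE hne)
  obtain ⟨σ, hd, ht⟩ := hw ρ hρ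
  refine not_borel_or_conj_Cs3_of_witness (G := ρ.toMonoidHom.range) (g := ρ σ) ⟨σ, rfl⟩ hd ht
    ⟨1, ?_⟩
  exact hcl.imp (fun h => by rintro _ ⟨τ, rfl⟩; rw [one_mul, inv_one, mul_one]; exact h τ)
    (fun h => by rintro _ ⟨τ, rfl⟩; rw [one_mul, inv_one, mul_one]; exact h τ)

/-- **«Large at 7» (flags `W7b + W7ns`) ⇒ modular whenever `3 ∤ [K : ℚ]` (e.g. `K` quartic),
modulo FLS Thm 4 + Kalyanswamy Thm 1.2 alone**; witnesses as in
`isModularEllipticCurve_of_witnesses_seven` (`Box2022.clause_seven_of_liftingTheorems` +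
`not_borel_or_conj_Ge7_of_witnesses`). [cite: FreitasLeHungSiksek2015, Thm. 4 and Prop. 1.1(c)] [cite: Kalyanswamy2018, Thm. 1.2] -/
theorem isModularEllipticCurve_of_witnesses_seven_of_not_three_dvd (h4 : FLS2015_theorem4)
    (hKal : Kalyanswamy2018_theorem1_2) :
    ∀ (K : Type) [Field K] [NumberField K], NumberField.IsTotallyReal K →
      ¬ 3 ∣ Module.finrank ℚ K → ∀ E : WeierstrassCurve (NumberField.RingOfIntegers K), E.Δ ≠ 0 →
      (∀ ρ : FramedGaloisRep K (ZMod 7) 2,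
        (∃ e : (E.baseChange K).geomTorsion ((7 : ℕ) : ℤ) ≃+ (Fin 2 → ZMod 7),
          ∀ (σ : Field.absoluteGaloisGroup K) (P : (E.baseChange K).geomTorsion ((7 : ℕ) : ℤ)),
            e (σ • P) = ((ρ σ : GL (Fin 2) (ZMod 7)) : Matrix (Fin 2) (Fin 2) (ZMod 7)) *ᵥ (e P)) →
        (∃ σ : Field.absoluteGaloisGroup K,
          ¬ IsSquare (Matrix.trace ((ρ σ : GL (Fin 2) (ZMod 7)) : Matrix (Fin 2) (Fin 2) (ZMod 7)) ^ 2 -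
            4 * Matrix.det ((ρ σ : GL (Fin 2) (ZMod 7)) : Matrix (Fin 2) (Fin 2) (ZMod 7)))) ∧
        (∃ σ : Field.absoluteGaloisGroup K,
          Matrix.trace ((ρ σ : GL (Fin 2) (ZMod 7)) : Matrix (Fin 2) (Fin 2) (ZMod 7)) ≠ 0 ∧
          IsSquare (Matrix.trace ((ρ σ : GL (Fin 2) (ZMod 7)) : Matrix (Fin 2) (Fin 2) (ZMod 7)) ^ 2 -
            4 * Matrix.det ((ρ σ : GL (Fin 2) (ZMod 7)) : Matrix (Fin 2) (Fin 2) (ZMod 7))) ∧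
          Matrix.trace ((ρ σ : GL (Fin 2) (ZMod 7)) : Matrix (Fin 2) (Fin 2) (ZMod 7)) ^ 2 -
            4 * Matrix.det ((ρ σ : GL (Fin 2) (ZMod 7)) : Matrix (Fin 2) (Fin 2) (ZMod 7)) ≠ 0)) →
      IsModularEllipticCurve K E := by
  intro K _ _ hK h3dvd E hE hw
  haveI := hK
  by_contra hne
  obtain ⟨ρ, hρ, hcl⟩ := Box2022.clause_seven_of_liftingTheorems h4 hKal K E hE
    (not_isAutomorphicOfWeightZero_of_not_isModularEllipticCurve hE hne)
    fun x => Box2022.cubic7_ne_zero h3dvd x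
  obtain ⟨⟨σ, hns⟩, σ', ht', hD', hD0'⟩ := hw ρ hρ
  refine not_borel_or_conj_Ge7_of_witnesses (G := ρ.toMonoidHom.range) (g := ρ σ) (g' := ρ σ')
    ⟨σ, rfl⟩ hns ⟨σ', rfl⟩ ht' hD' hD0' ⟨1, ?_⟩
  exact hcl.imp (fun h => by rintro _ ⟨τ, rfl⟩; rw [one_mul, inv_one, mul_one]; exact h τ)
    (fun h => by rintro _ ⟨τ, rfl⟩; rw [one_mul, inv_one, mul_one]; exact h τ)

/-- **«Large at 7» from ONE Frobenius ⇒ modular whenever `3 ∤ [K : ℚ]`, modulo FLS Thm 4 +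
Kalyanswamy Thm 1.2 alone**: for every framing of `E[7]` some `ρ̄(σ)` has `det ∈ {3, 5, 6}`, non-zero
trace and non-square `trace² − 4 det`. [cite: FreitasLeHungSiksek2015, Thm. 4 and Prop. 1.1(c)] [cite: Kalyanswamy2018, Thm. 1.2] -/
theorem isModularEllipticCurve_of_witness_seven_of_not_three_dvd (h4 : FLS2015_theorem4)
    (hKal : Kalyanswamy2018_theorem1_2) :
    ∀ (K : Type) [Field K] [NumberField K], NumberField.IsTotallyReal K →
      ¬ 3 ∣ Module.finrank ℚ K → ∀ E : WeierstrassCurve (NumberField.RingOfIntegers K), E.Δ ≠ 0 →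
      (∀ ρ : FramedGaloisRep K (ZMod 7) 2,
        (∃ e : (E.baseChange K).geomTorsion ((7 : ℕ) : ℤ) ≃+ (Fin 2 → ZMod 7),
          ∀ (σ : Field.absoluteGaloisGroup K) (P : (E.baseChange K).geomTorsion ((7 : ℕ) : ℤ)),
            e (σ • P) = ((ρ σ : GL (Fin 2) (ZMod 7)) : Matrix (Fin 2) (Fin 2) (ZMod 7)) *ᵥ (e P)) →
        ∃ σ : Field.absoluteGaloisGroup K,
          (Matrix.det ((ρ σ : GL (Fin 2) (ZMod 7)) : Matrix (Fin 2) (Fin 2) (ZMod 7)) = 3 ∨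
            Matrix.det ((ρ σ : GL (Fin 2) (ZMod 7)) : Matrix (Fin 2) (Fin 2) (ZMod 7)) = 5 ∨
            Matrix.det ((ρ σ : GL (Fin 2) (ZMod 7)) : Matrix (Fin 2) (Fin 2) (ZMod 7)) = 6) ∧
          Matrix.trace ((ρ σ : GL (Fin 2) (ZMod 7)) : Matrix (Fin 2) (Fin 2) (ZMod 7)) ≠ 0 ∧
          ¬ IsSquare (Matrix.trace ((ρ σ : GL (Fin 2) (ZMod 7)) : Matrix (Fin 2) (Fin 2) (ZMod 7)) ^ 2 -
            4 * Matrix.det ((ρ σ : GL (Fin 2) (ZMod 7)) : Matrix (Fin 2) (Fin 2) (ZMod 7)))) →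
      IsModularEllipticCurve K E := by
  intro K _ _ hK h3dvd E hE hw
  haveI := hK
  by_contra hne
  obtain ⟨ρ, hρ, hcl⟩ := Box2022.clause_seven_of_liftingTheorems h4 hKal K E hE
    (not_isAutomorphicOfWeightZero_of_not_isModularEllipticCurve hE hne)
    fun x => Box2022.cubic7_ne_zero h3dvd x
  obtain ⟨σ, hd, ht, hns⟩ := hw ρ hρ
  refine not_borel_or_conj_Ge7_of_witness (G := ρ.toMonoidHom.range) (g := ρ σ) ⟨σ, rfl⟩ hd ht
    hns ⟨1, ?_⟩
  exact hcl.imp (fun h => by rintro _ ⟨τ, rfl⟩; rw [one_mul, inv_one, mul_one]; exact h τ)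
    (fun h => by rintro _ ⟨τ, rfl⟩; rw [one_mul, inv_one, mul_one]; exact h τ)

end Summit.Langlands.Langlands.Theorems.SqrtFiveQuarticCovers
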